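import Summits.ResolutionOfSingularities.ResolutionOfSingularities.Theorems.AbsoluteGiraudKernel
import Summits.ResolutionOfSingularities.ResolutionOfSingularities.Theorems.FrobeniusLadderFInjectiveMacaulayficationCentreSpread
import HarnessLib

/-!
# AbsoluteGiraudBranch — decomp-res node «AbsoluteGiraud» (lens-6 g16), tree file 7/7: §7 ALONG A CORE BRANCH
— `absInv_succ`, `absInv_strictIter`
and the headline THEOREM `absGiraud3 : AbsGiraud3` (hypothesis-free, standard axioms: absolute `ℤ`-linear maximal
contact at the root of a core
branch at marking 3 is permanent along the branch, point AND foreign rounds; the germ is spread by the tree's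
`CentreSpread.centreSpread`);
§8 ASSEMBLY to the scope class BY NAME with TWO inputs: `closes (hA : AbsContactOff3) (hH : HypHug3Insep) :
AllHug3Off3`, `closes_imp`, and the
EXACT iffs modulo the new lemma `off3Insep_iff_hypHug3Insep`, `allHug3Off3_iff_hypHug3Insep`,
`allHug3Off3Imp_iff_hypHug3Insep`; `pieces_of_allHug3Off3`.

Content VERBATIM from the decomp-res lens-6 g16 file `HOME/decomp-res-lens-6/g16/AbsoluteGiraud.lean` (sha256
bc25b5879a7322cd; CRITIC-LEDGER row 118
CLEARED: MAP +1; it SUPERSEDES g15 `AbsoluteContact.lean` cca8a261, rows 110–112, whose §1–§5 are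
byte-identical).  HOME = run/shared/lean/pub/decomp-res.
Host: route `MaxContactCut`, aside 31574 `PVPureGame` through the lens-6 chain SatelliteExit (tree
`Theorems/SatelliteExitClasses`) → g12–g14
BoundaryValve / SwitchExclusion / MemberCalculus (HOME, critic rows 87/93/103; not yet in the tree) → the scope
class `AllHug3Off3` (§1 here).

[WRITER NOTE (decomp-res writer g6): the lens file is split into `AbsoluteContactScope` (§0 g12 vocabulary over the
landed `Branch` + §1 the
scope class and the perfect half) → `AbsoluteContactPrimitives` (§2, landed earlier) →
`AbsoluteContactHasseRing` / `AbsoluteContactHasse` (§3a/§3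
the separable-residue Hasse lemma IN KERNEL) → `AbsoluteContactAxes` (§4/§5 the two axes: residue field of the
root point; absolute contact) →
`AbsoluteGiraudKernel` (§6 scheme-level Giraud persistence of absolute contact under one blowing up) →
`AbsoluteGiraudBranch` (§7 `absGiraud3`,
§8 assembly).  The two Theses-cone imports of the lens file (`Theses.MaxContactCut`, `MaxContactCutPurityValve`)
are unused and dropped, so every
file is route-importable; `set_option` lines dropped; nothing else changed.]
(Sources: Giraud1975; EncinasVillamayor2000 Thm. 4.9; BravoGarciaEscamillaVillamayor2012 Lemma 4.6;
VillamayorU2008ReesDiff §4; CossartPiltant2008 §2; CossartJannsenSaito2020.)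
-/

noncomputable section

open CategoryTheory AlgebraicGeometry TopologicalSpace
open Literature.AlgebraicGeometry.Resolution
open Summit.ResolutionOfSingularities.ResolutionOfSingularities.Theorems
open WeakOrderReduction ForcedTowerClasses PurityValveClasses
open SatelliteExitClasses

namespace Summit.ResolutionOfSingularities.ResolutionOfSingularities.Theorems.AbsoluteContactClasses

/-! ## §7 (g16 · NEW · KERNEL) Along a CORE branch: `absGiraud3 : AbsGiraud3` -/

section BranchKernel

open IsLocalRing

variable {k : Type} [Field k]

/-- The stages of a branch are locally Noetherian (finite type over a field). [folklore] -/
theorem isLocallyNoetherian_St (B : Branch k) (i : ℕ) : IsLocallyNoetherian (B.St i) := by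
  haveI : LocallyOfFiniteType (B.str i) := (B.base i).locallyOfFiniteType
  exact LocallyOfFiniteType.isLocallyNoetherian (B.str i)

/-- The stages of a branch are Noetherian schemes (finite type and quasi-compact over a field). [folklore] -/
theorem isNoetherian_St (B : Branch k) (i : ℕ) : IsNoetherian (B.St i) := by
  haveI := isLocallyNoetherian_St B i
  haveI : QuasiCompact (B.str i) := (B.base i).quasiCompact
  haveI : CompactSpace ↥(Spec (.of k)) := inferInstance
  haveI : CompactSpace ↥(B.St i) := QuasiCompact.compactSpace_of_compactSpace (B.str i)
  exact {}

/-- The marking is constant along the branch. [folklore] -/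
theorem mult_eq_of_isDatum (B : Branch k) {n : ℕ} (hD : IsDatum n (B.D 0)) : ∀ i, (B.D i).mult = n := by
  intro i
  induction i with
  | zero => exact hD.1
  | succ i ih => rw [B.transform_eq i, MarkedIdeal.transform_mult, ih]

/-- **One blow-up of a core branch preserves the invariant** (point round: chart + Giraud over `ℤ`; foreign round: local
isomorphism). (Sources: EncinasVillamayor2000, Thm. 4.9.) -/
theorem absInv_succ (B : Branch k) (i : ℕ) (H : (B.St i).IdealSheafData) (hmult : (B.D i).mult = 3)
    (hci : IsCorePt (B.str i) (B.base i).isRegular (B.D i).ideal 3 (B.pt i))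
    (hci1 : IsCorePt (B.str (i + 1)) (B.base (i + 1)).isRegular (B.D (i + 1)).ideal 3 (B.pt (i + 1)))
    (h : AbsInv (B.D i).ideal H 2 (B.pt i)) :
    AbsInv (B.D (i + 1)).ideal (strictTransformIdeal (B.π i) (B.centre i) H) 2 (B.pt (i + 1)) := by
  haveI := isLocallyNoetherian_St B i
  haveI := isLocallyNoetherian_St B (i + 1)
  have hπ := B.isBlowup i
  have hy : (B.π i).base (B.pt (i + 1)) = B.pt i := B.pt_map i
  have hDi1 : (B.D (i + 1)).ideal = controlledTransform (B.π i) (B.centre i) (B.D i).ideal 3 := by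
    rw [B.transform_eq i, MarkedIdeal.transform_ideal, hmult]
  rw [hDi1]
  have h' : AbsInv (B.D i).ideal H 2 ((B.π i).base (B.pt (i + 1))) := by rw [hy]; exact h
  have hI3 : stalkIdeal (B.D i).ideal ((B.π i).base (B.pt (i + 1))) ≤ maximalIdeal _ ^ 3 := by
    rw [hy]; exact (le_idealOrder_iff _ _ 3).mp hci.1.ge
  have hI'3 : stalkIdeal (controlledTransform (B.π i) (B.centre i) (B.D i).ideal 3) (B.pt (i + 1)) ≤
      maximalIdeal _ ^ 3 := by
    have := (le_idealOrder_iff _ _ 3).mp hci1.1.ge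
    rwa [hDi1] at this
  rcases B.kind i with hpt | hfor
  · have hpt' : ((B.centre i).support : Set (B.St i)) = {(B.π i).base (B.pt (i + 1))} := by rw [hy]; exact hpt
    have hcl : IsClosed ({(B.π i).base (B.pt (i + 1))} : Set (B.St i)) := by rw [hy]; exact B.isClosed_pt i
    exact absInv_point hπ (B.base i).isRegular (B.centre_regular i) _ H 2 _ hcl hpt' hI3 hI'3 h'
  · have hfor' : (B.π i).base (B.pt (i + 1)) ∉ ((B.centre i).support : Set (B.St i)) := by rw [hy]; exact hfor
    exact absInv_foreign hπ _ H 2 3 _ hfor' h'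

/-- **KERNEL (PROVED): the invariant at every stage of a core branch started at an absolute contact element.**
(Sources: EncinasVillamayor2000, Thm. 4.9.) -/
theorem absInv_strictIter (B : Branch k) (hD : IsDatum 3 (B.D 0)) (hcore : B.Core) (H : (B.St 0).IdealSheafData)
    {u : (B.St 0).presheaf.stalk (B.pt 0)} (hHst : stalkIdeal H (B.pt 0) = Ideal.span {u})
    (hu : u ∈ diffIdeal ℤ 2 (stalkIdeal (B.D 0).ideal (B.pt 0))) (hum : u ∈ maximalIdeal _) (hu2 : u ∉ maximalIdeal _ ^ 2) :
    ∀ j, AbsInv (B.D (0 + j)).ideal (strictIter B 0 H j) 2 (B.pt (0 + j)) := by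
  intro j
  induction j with
  | zero => exact ⟨u, hHst, hu, hum, hu2⟩
  | succ j ih =>
    exact absInv_succ B (0 + j) (strictIter B 0 H j) (mult_eq_of_isDatum B hD (0 + j)) (hcore (0 + j))
      (hcore (0 + j + 1)) ih

/-- **THEOREM (g16): `AbsGiraud3` — g15's Giraud PORT is PROVED.**  Absolute `Diff^{≤2}_ℤ`-contact at the root
of a core branch of the
class spreads to a regular hypersurface germ `V(H) ∋ pt 0` (tree `centreSpread`) which the branch HUGS FOR EVER
(`absInv_strictIter`). (Sources: EncinasVillamayor2000, Thm. 4.9; BravoGarciaEscamillaVillamayor2012, Lemma 4.6.) -/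
theorem absGiraud3 : AbsGiraud3 := by
  intro p hp hp3 k _ _ B hD hcore habs
  obtain ⟨u, hu, hum, hu2⟩ := habs
  haveI := isNoetherian_St B 0
  haveI := isLocallyNoetherian_St B 0
  have hu0 : u ≠ 0 := fun h => hu2 (by rw [h]; exact zero_mem _)
  have hspan : Ideal.span (Set.range fun _ : Fin 1 => u) = Ideal.span {u} := by rw [Set.range_const]
  obtain ⟨H, -, -, hHst⟩ := FInjectiveMacaulayfication.CentreSpread.centreSpread (B.St 0) (B.pt 0) 1 (fun _ => u)
      (by rw [hspan, Ne, Ideal.span_singleton_eq_bot]; exact hu0)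
      (by rw [hspan]; exact (Ideal.span_singleton_le_iff_mem _).mpr hum)
  rw [hspan] at hHst
  have hinv := absInv_strictIter B hD hcore H hHst hu hum hu2
  refine ⟨H, ⟨?_, fun j => ?_⟩, u, hu, hHst, hum, hu2⟩
  · have hne : stalkIdeal H (B.pt 0) ≠ ⊥ := by rw [hHst, Ne, Ideal.span_singleton_eq_bot]; exact hu0
    exact (idealOrder_lt_top_of_stalkIdeal_ne_bot hne).ne
  · obtain ⟨z, hHz, -, hzm, -⟩ := hinv j
    exact (mem_support_iff_stalkIdeal_le _ _).mpr (by rw [hHz]; exact (Ideal.span_singleton_le_iff_mem _).mpr hzm)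

end BranchKernel

/-! ## §8 Assembly to the target by name (g16: TWO inputs) -/

/-- **`closes`** (g16: TWO inputs — the Giraud port is now the theorem `absGiraud3`) — the `p ≠ 3` aside
`AllHug3Off3` (g13/g14, all
fields) from the NEW LEMMA (absolute contact; desk-proved, kernel in the perfect and separable-residue cases) and
the located residual
(31571-imp-shaped). PROVED. [folklore] -/
theorem closes (hA : AbsContactOff3) (hH : HypHug3Insep) : AllHug3Off3 :=
  allHug3Off3_iff_off3Insep.2 (off3Insep_of_pieces hA absGiraud3 hH)

/-- **`closes_imp`** — g14's undecided seam piece `AllHug3Off3Imp` from the same two inputs. PROVED. [folklore] -/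
theorem closes_imp (hA : AbsContactOff3) (hH : HypHug3Insep) : AllHug3Off3Imp :=
  allHug3Off3_iff_imp.1 (closes hA hH)

/-- **kernel (EXACT mod the new lemma, PROVED)**: given `AbsContactOff3`, the located residual IS g15's residue
slice `Off3Insep`.
[folklore] -/
theorem off3Insep_iff_hypHug3Insep (hA : AbsContactOff3) : Off3Insep ↔ HypHug3Insep :=
  ⟨fun h p hp hp3 k _ _ B hs hD hb hAc hC hPu hE _ => h p hp hp3 k B hs hD hb hAc hC hPu hE,
    fun h => off3Insep_of_pieces hA absGiraud3 h⟩

/-- **kernel (EXACT mod the new lemma, PROVED)**: given `AbsContactOff3`, the located residual IS the whole aside `AllHug3Off3`.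
[folklore] -/
theorem allHug3Off3_iff_hypHug3Insep (hA : AbsContactOff3) : AllHug3Off3 ↔ HypHug3Insep :=
  allHug3Off3_iff_off3Insep.trans (off3Insep_iff_hypHug3Insep hA)

/-- **kernel (EXACT mod the new lemma, PROVED)**: … and IS g14's imperfect-field seam `AllHug3Off3Imp`. [folklore] -/
theorem allHug3Off3Imp_iff_hypHug3Insep (hA : AbsContactOff3) : AllHug3Off3Imp ↔ HypHug3Insep :=
  allHug3Off3_iff_imp.symm.trans (allHug3Off3_iff_hypHug3Insep hA)

/-- g15 rev1 form of `closes` (three inputs; the second is now discharged by `absGiraud3`). [folklore] -/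
theorem closes_g15 (hA : AbsContactOff3) (hG : AbsGiraud3) (hH : HypHug3Insep) : AllHug3Off3 :=
  allHug3Off3_iff_off3Insep.2 (off3Insep_of_pieces hA hG hH)

/-- **the residual alone decides the seam** (`allHug3Off3_iff_off3Insep`, ⇐). [folklore] -/
theorem allHug3Off3_of_residual (hI : Off3Insep) : AllHug3Off3 :=
  allHug3Off3_iff_off3Insep.2 hI

/-- sanity (PROVED): conversely the target gives back every piece of the cut. [folklore] -/
theorem pieces_of_allHug3Off3 (h : AllHug3Off3) : Off3Sep ∧ Off3Insep ∧ HypHug3Insep ∧ AbsGiraud3 :=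
  ⟨(allHug3Off3_iff_residue.1 h).1, (allHug3Off3_iff_residue.1 h).2,
    fun p hp hp3 k _ _ B hs hD hb hA hC hPu hE _ => (allHug3Off3_iff_residue.1 h).2 p hp hp3 k B hs hD hb hA hC hPu hE,
    absGiraud3⟩

end Summit.ResolutionOfSingularities.ResolutionOfSingularities.Theorems.AbsoluteContactClasses
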